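import Literature.Topology.CoveringSpaces.CoveringSubsingletonFiber

/-!
# Stub S2 of line `universal-cover-strips-topology` (crux `AhHadamardFilling`):
# sheets of a covering by a one-ended simply connected space

Let `F : E → Y` be a surjective covering map from a simply connected space `E` with the ONE-END
property (two disjoint open subsets with compact frontiers cannot both have non-compact closure)
onto a path connected space `Y`, and let `U ⊆ Y` be open with compact frontier and NON-compact
closure, `closure U` lying in the open range of a topological embedding `ι : T → Y` of a simply
connected, locally path connected space. Then `Y` is simply connected
(`stub_coverSheetsSimplyConnected`).

Proof (Hatcher 2002, §1.3): through each point over `ι t₀` there is a lift `s : T → E` of `ι`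
(lifting criterion, tree `Literature.Topology.CoveringSpaces.exists_lift_isOpen_range`) with open
range; lifts whose ranges meet coincide (uniqueness of lifts); the sheet `s '' (ι ⁻¹' U)` is open,
its closure stays inside `range s` and maps onto `closure U` (so it is not compact), and its
frontier is the lift of `frontier U` (compact). Two points in one fibre would give two disjoint
such sheets, contradicting the one-end property; so a fibre is a point and
`simplyConnectedSpace_of_isCoveringMap_of_subsingleton_fiber` concludes.

## References

* A. Hatcher, *Algebraic Topology* (2002), §1.3, Props. 1.33, 1.34, 1.39. [HatcherAT2002]
-/

noncomputable section

-- the prescribed namespace `Summit.<P>.<Sub>.…` duplicates `SmoothPoincare4` (P = Sub)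
set_option linter.dupNamespace false

open Set Function Topology

namespace Summit.SmoothPoincare4.SmoothPoincare4.Cruxes.AhHadamardFilling.UniversalCoverStripsTopology

section Sheets

variable {E Y T : Type*} [TopologicalSpace E] [TopologicalSpace Y] [TopologicalSpace T]
  {F : E → Y} {ι : T → Y}

/-- **Lifts whose ranges meet coincide.** Two lifts `s, s'` of the embedding `ι` through the
covering map `F` with `s a = s' b` for some `a, b` are equal: `ι a = F (s a) = F (s' b) = ι b`
forces `a = b`, and lifts agreeing at one point of a connected space agree everywhere
(Hatcher 2002, Prop. 1.34; Mathlib's `IsCoveringMap.eq_of_comp_eq`). [cite: HatcherAT2002, §1.3] -/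
private theorem lift_eq_of_apply_eq [PreconnectedSpace T] (hF : IsCoveringMap F)
    (hι : IsEmbedding ι) {s s' : C(T, E)} (hs : F ∘ s = ι) (hs' : F ∘ s' = ι) {a b : T}
    (hab : s a = s' b) : s = s' := by
  have h1 : F (s a) = ι a := congr_fun hs a
  have h2 : F (s' b) = ι b := congr_fun hs' b
  have hιab : ι a = ι b := by rw [← h1, ← h2, hab]
  obtain rfl := hι.injective hιab
  exact ContinuousMap.ext
    (congr_fun (hF.eq_of_comp_eq s.continuous s'.continuous (hs.trans hs'.symm) a hab))

/-- **Lifts with open range.** Through every point `e` over `ι t` there is a lift `s` of `ι`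
through the covering map `F` with `s t = e` (lifting criterion for the simply connected, locally
path connected `T`, tree `exists_lift_isOpen_range`), and when `range ι` is open in `Y` the range
of `s` — open in the open set `F ⁻¹' (range ι)` — is open in `E`. [cite: HatcherAT2002, §1.3] -/
private theorem exists_lift_isOpen_range' [SimplyConnectedSpace T] [LocallyPathConnectedSpace T]
    (hF : IsCoveringMap F) (hι : IsEmbedding ι) (hιo : IsOpen (range ι)) {t : T} {e : E}
    (he : F e = ι t) : ∃ s : C(T, E), F ∘ s = ι ∧ s t = e ∧ IsOpen (range s) := by
  obtain ⟨s, hs, hst, hso⟩ :=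
    Literature.Topology.CoveringSpaces.exists_lift_isOpen_range hF hι he
  refine ⟨s, hs, hst, ?_⟩
  have hWo : IsOpen (F ⁻¹' range ι) := hιo.preimage hF.continuous
  have hsub : range s ⊆ F ⁻¹' range ι := by
    rintro _ ⟨τ, rfl⟩
    exact ⟨τ, (congr_fun hs τ).symm⟩
  have h := hWo.isOpenMap_subtype_val _ hso
  rwa [Subtype.image_preimage_coe, inter_eq_right.2 hsub] at h

/-- **A sheet lies over `U`, its closure over `closure U`.** For a lift `s` of `ι` through the
(continuous) map `F`, every point of `closure (s '' (ι ⁻¹' U))` maps into `closure U`, because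
`F` maps the sheet `s '' (ι ⁻¹' U)` into `U`. [folklore] -/
private theorem apply_mem_closure_of_mem_closure_sheet (hFc : Continuous F) {U : Set Y}
    {s : C(T, E)} (hs : F ∘ s = ι) {e : E} (he : e ∈ closure (s '' (ι ⁻¹' U))) :
    F e ∈ closure U := by
  have hFV : F '' (s '' (ι ⁻¹' U)) ⊆ U := by
    rintro _ ⟨_, ⟨τ, hτ, rfl⟩, rfl⟩
    have h1 : F (s τ) = ι τ := congr_fun hs τ
    show F (s τ) ∈ U
    rw [h1]
    exact hτ
  exact closure_mono hFV (image_closure_subset_closure_image hFc ⟨e, he, rfl⟩)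

/-- **The closure of a sheet stays in its layer**: `closure (s '' (ι ⁻¹' U)) ⊆ range s` when
`closure U ⊆ range ι` and `range ι` is open. A point `e` of the closure lies over
`closure U ⊆ range ι`, say over `ι t`; the lift of `ι` through `e` at `t` has open range, which
meets the sheet and hence `range s`, so that lift is `s` and `e = s t`.
[cite: HatcherAT2002, §1.3] -/
private theorem closure_sheet_subset_range [SimplyConnectedSpace T] [LocallyPathConnectedSpace T]
    (hF : IsCoveringMap F) (hι : IsEmbedding ι) (hιo : IsOpen (range ι)) {U : Set Y}
    (hUι : closure U ⊆ range ι) {s : C(T, E)} (hs : F ∘ s = ι) :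
    closure (s '' (ι ⁻¹' U)) ⊆ range s := by
  intro e he
  obtain ⟨t, ht⟩ := hUι (apply_mem_closure_of_mem_closure_sheet hF.continuous hs he)
  obtain ⟨s', hs', hs't, hs'o⟩ := exists_lift_isOpen_range' hF hι hιo ht.symm
  obtain ⟨x, ⟨a, rfl⟩, ⟨b, -, hab⟩⟩ :=
    mem_closure_iff_nhds.1 he _ (hs'o.mem_nhds ⟨t, hs't⟩)
  obtain rfl : s = s' := lift_eq_of_apply_eq hF hι hs hs' hab
  exact ⟨t, hs't⟩

/-- **One sheet over `U`.** For a lift `s` of `ι` with open range (`range ι` open,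
`closure U ⊆ range ι`, `U` open), the sheet `V = s '' (ι ⁻¹' U) = range s ∩ F ⁻¹' U` is open; its
frontier lies in `s '' (ι ⁻¹' (frontier U))`, which is compact when `frontier U` is (`ι` is an
embedding); and `F '' (closure V) ⊇ closure U`, so `closure V` is not compact when `closure U` is
not. [cite: HatcherAT2002, §1.3] -/
private theorem sheet_isOpen_frontier_closure [SimplyConnectedSpace T]
    [LocallyPathConnectedSpace T] (hF : IsCoveringMap F) (hι : IsEmbedding ι)
    (hιo : IsOpen (range ι)) {U : Set Y} (hUo : IsOpen U) (hUι : closure U ⊆ range ι)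
    (hUfr : IsCompact (frontier U)) (hUcl : ¬ IsCompact (closure U)) {s : C(T, E)}
    (hs : F ∘ s = ι) (hso : IsOpen (range s)) :
    IsOpen (s '' (ι ⁻¹' U)) ∧ IsCompact (frontier (s '' (ι ⁻¹' U))) ∧
      ¬ IsCompact (closure (s '' (ι ⁻¹' U))) := by
  have hsl : ∀ τ, F (s τ) = ι τ := fun τ ↦ congr_fun hs τ
  have hVeq : s '' (ι ⁻¹' U) = range s ∩ F ⁻¹' U := by
    ext x
    constructor
    · rintro ⟨τ, hτ, rfl⟩
      refine ⟨⟨τ, rfl⟩, ?_⟩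
      show F (s τ) ∈ U
      rw [hsl]
      exact hτ
    · rintro ⟨⟨τ, rfl⟩, hx⟩
      refine ⟨τ, ?_, rfl⟩
      show ι τ ∈ U
      rw [← hsl]
      exact hx
  have hVo : IsOpen (s '' (ι ⁻¹' U)) := by
    rw [hVeq]
    exact hso.inter (hUo.preimage hF.continuous)
  have hclV : closure (s '' (ι ⁻¹' U)) ⊆ range s := closure_sheet_subset_range hF hι hιo hUι hs
  refine ⟨hVo, ?_, ?_⟩
  · -- `frontier V ⊆ s '' (ι ⁻¹' frontier U)`, a continuous image of a compact set
    have hK : IsCompact (ι ⁻¹' frontier U) :=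
      (hι.isInducing.isCompact_preimage_iff (frontier_subset_closure.trans hUι)).2 hUfr
    refine (hK.image s.continuous).of_isClosed_subset isClosed_frontier ?_
    intro e he
    rw [hVo.frontier_eq] at he
    obtain ⟨hecl, heV⟩ := he
    obtain ⟨τ, rfl⟩ := hclV hecl
    refine ⟨τ, ?_, rfl⟩
    show ι τ ∈ frontier U
    rw [hUo.frontier_eq]
    refine ⟨?_, fun hU ↦ heV ⟨τ, hU, rfl⟩⟩
    rw [← hsl]
    exact apply_mem_closure_of_mem_closure_sheet hF.continuous hs hecl
  · -- `closure U ⊆ F '' closure V`, so compactness of `closure V` would force that of `closure U`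
    intro hcpt
    refine hUcl ((hcpt.image hF.continuous).of_isClosed_subset isClosed_closure ?_)
    intro y hy
    obtain ⟨τ, rfl⟩ := hUι hy
    have hτ : τ ∈ closure (ι ⁻¹' U) := by
      rw [hι.isInducing.closure_eq_preimage_closure_image,
        image_preimage_eq_of_subset (subset_closure.trans hUι)]
      exact hy
    exact ⟨s τ, image_closure_subset_closure_image s.continuous ⟨τ, hτ, rfl⟩, hsl τ⟩

end Sheets

/-- **S2 (`coverSheetsSimplyConnected`).** Let `F : E → Y` be a surjective covering map from a
simply connected space `E` with the one-end property of S1 onto a path connected space `Y`. Suppose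
`Y` contains an open set `U` with compact frontier and NON-compact closure, whose closure lies in
the open range of a topological embedding `ι : T → Y` of a simply connected, locally path connected
space. Then `Y` is simply connected. Proof: through each point of the fibre over a point `ι t₀ ∈ U`
there is a lift `s : T → E` of `ι` (lifting criterion, tree `exists_lift_isOpen_range`), distinct
lifts have disjoint open ranges (uniqueness of lifts), `s(ι⁻¹ U)` is open with closure
`≅ closure U` (non-compact) inside `range s` and frontier `≅ frontier U` (compact); by the one-end
property there is at most one lift, so the fibre is a point and
`simplyConnectedSpace_of_isCoveringMap_of_subsingleton_fiber` applies. [cite: HatcherAT2002, §1.3] -/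
theorem stub_coverSheetsSimplyConnected
    (E : Type) [TopologicalSpace E] [SimplyConnectedSpace E]
    (hE : ∀ (V₁ V₂ : Set E), IsOpen V₁ → IsOpen V₂ → Disjoint V₁ V₂ →
      IsCompact (frontier V₁) → IsCompact (frontier V₂) →
      IsCompact (closure V₁) ∨ IsCompact (closure V₂))
    (Y : Type) [TopologicalSpace Y] [PathConnectedSpace Y]
    (F : E → Y) (hF : IsCoveringMap F) (hFs : Surjective F)
    (T : Type) [TopologicalSpace T] [SimplyConnectedSpace T] [LocallyPathConnectedSpace T]
    (ι : T → Y) (hι : Topology.IsEmbedding ι) (hιo : IsOpen (range ι))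
    (U : Set Y) (hUo : IsOpen U) (hUι : closure U ⊆ range ι)
    (hUfr : IsCompact (frontier U)) (hUcl : ¬ IsCompact (closure U)) :
    SimplyConnectedSpace Y := by
  -- `U` is nonempty (its closure is not compact); pick `ι t₀ ∈ U`
  obtain ⟨y₀, hy₀⟩ : U.Nonempty := by
    by_contra h
    rw [not_nonempty_iff_eq_empty] at h
    refine hUcl ?_
    rw [h, closure_empty]
    exact isCompact_empty
  obtain ⟨t₀, rfl⟩ := hUι (subset_closure hy₀)
  refine Literature.Topology.CoveringSpaces.simplyConnectedSpace_of_isCoveringMap_of_subsingleton_fiber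
    hF hFs (y₀ := ι t₀) ?_
  -- the fibre over `ι t₀` is a subsingleton: two points give two disjoint sheets over `U`
  intro e₁ he₁ e₂ he₂
  obtain ⟨s₁, hs₁, hs₁t, hs₁o⟩ := exists_lift_isOpen_range' hF hι hιo (mem_singleton_iff.1 he₁)
  obtain ⟨s₂, hs₂, hs₂t, hs₂o⟩ := exists_lift_isOpen_range' hF hι hιo (mem_singleton_iff.1 he₂)
  by_contra hne
  have hdisj : Disjoint (range s₁) (range s₂) := by
    rw [disjoint_left]
    rintro _ ⟨a, rfl⟩ ⟨b, hb⟩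
    obtain rfl : s₂ = s₁ := lift_eq_of_apply_eq hF hι hs₂ hs₁ hb
    exact hne (hs₁t.symm.trans hs₂t)
  obtain ⟨hV₁o, hV₁fr, hV₁cl⟩ := sheet_isOpen_frontier_closure hF hι hιo hUo hUι hUfr hUcl hs₁ hs₁o
  obtain ⟨hV₂o, hV₂fr, hV₂cl⟩ := sheet_isOpen_frontier_closure hF hι hιo hUo hUι hUfr hUcl hs₂ hs₂o
  rcases hE _ _ hV₁o hV₂o (hdisj.mono (image_subset_range _ _) (image_subset_range _ _))
      hV₁fr hV₂fr with h | h
  · exact hV₁cl h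
  · exact hV₂cl h

end Summit.SmoothPoincare4.SmoothPoincare4.Cruxes.AhHadamardFilling.UniversalCoverStripsTopology

end
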